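import Summits.PneNP.PneNP.Theorems.ChebyshevTracialDesignAPrioriPsdExplicit
import HarnessLib

/-!
# Cell pnp-psdrank, route `ChebyshevTracialDesign`: the crux REDUCED TO THE LOW MODES — a lower bound
# `Σ_{κ=1}^{D/2} ρ_{2κ}·C_κ ≥ −ε·r·|PM|·N₁` on tight psd strategies gives `TracialValueLEAt W (ε + (c'+B)·√P_D) r`

Harmonic backbone of the crux `TracialDecayExp20` (stmt-PneNP-19878), brick 45g (prover g10): the composition of the mode budget (45c), the
Hilbert–Schmidt Parseval bound (45d/45e `HSmode_abs_le`, 45f `deep_modes_le`) and the truncation step (brick 35 `tracialValueLEAt_of_virtualNonneg`)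
as a REDUCTION. For `n` even, an exact design `(n, t = 2c'+1, T, D ≤ 2c', B, C, w)`, `r ≥ 1` and `ε`:
* **`tracialValueLEAt_of_lowModes`** — if every tight psd strategy `(X, Y)` of dimension `r` (`IsPsdRect X Y`) with entrywise harmonic layers `p`
  of `X` on the `t`-cuts satisfies the LOW-MODE INEQUALITY `−ε·r·|PM|·N₁ ≤ Σ_{κ=1}^{D/2} (R_κ − 1)·C_κ(X, Y, p)`
  (`R_κ − 1 = ρ_{2κ} = O(κ/n)`, `C_κ` the Hilbert–Schmidt tight mode of layer `2κ`), then `TracialValueLEAt (levelWeight n t C w) (ε + (c' + B)·√P_D) r`.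
  With `ε = e^{−a·dq n}/2` and `(c'+B)√P_D ≤ e^{−a dq n}/2` (true for the route's parameters, `P_D = n^{−Ω(D)}`) the conclusion is the crux's
  `TracialValueLEAt W e^{−a dq n} r`: the crux is EQUIVALENT, up to the exponentially small deep tail, to the low-mode inequality — for 0/1 rectangles
  NTF (brick 50c) proves it via Keevash–Lifshitz + Kupavskii–Zakharov structure; for psd it is the open core (a-priori only `O(r·n^{−3/2})`, brick 45f).
[cite: Grigoriev2001, Lemma 1.4 (PDF p. 8)] [cite: Rothvoss2017, §2 (PDF p. 6)] [cite: GriblingDelaatLaurent2019, §5]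
Stature: support/instrument (no defs), a reduction. WHAT THIS IS NOT: no proof of the low-mode inequality; nothing on psd rank; no P-vs-NP content.
Supports stmt-PneNP-19878.
-/

set_option linter.dupNamespace false -- `Summit.PneNP.PneNP.…`: summit = sub-problem (D-0017)

noncomputable section

namespace Summit.PneNP.PneNP.Theorems.ChebyshevTracialDesignLowModeReduction

open Finset Matrix Literature.Barriers.PneNP Literature.Computability.Complexity Literature.Combinatorics.Optimization
open Literature.Combinatorics.AssociationSchemes Literature.Combinatorics.AssociationSchemes.JohnsonHarmonics
open Summit.PneNP.PneNP.Theorems.ChebyshevTracialDesignTracialProfilePolynomial (tracialValueLEAt_of_virtualNonneg)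
open Summit.PneNP.PneNP.Theorems.ChebyshevTracialDesignProfilePolynomial (card_pmatch_pos)
open Summit.PneNP.PneNP.Theorems.ChebyshevTracialDesignAPrioriPsd (HSmode_abs_le)
open Summit.PneNP.PneNP.Theorems.ChebyshevTracialDesignAPrioriPsdExplicit (deep_modes_le)
open Summit.PneNP.PneNP.Theorems.ChebyshevTracialDesignTightModeBudget (tight_virtual_modeBudget)

variable {n : ℕ}

/-- **THE LOW-MODE REDUCTION.** For `n` even, an exact design `(n, t = 2c'+1, T, D ≤ 2c', B, C, w)` and `r ≥ 1`: if every tight psd strategy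
of dimension `r` satisfies `−ε·r·|PM|·N₁ ≤ Σ_{κ=1}^{D/2} (R_κ−1)·C_κ`, then `TracialValueLEAt (levelWeight n t C w) (ε + (c'+B)·√P_D) r`.
[cite: Grigoriev2001, Lemma 1.4 (PDF p. 8)] [cite: Rothvoss2017, §2 (PDF p. 6)] [cite: GriblingDelaatLaurent2019, §5] -/
theorem tracialValueLEAt_of_lowModes {c' T D r : ℕ} {Bv ε : ℝ} {C : Finset ℕ} {w : ℕ → ℝ} (hn : Even n)
    (hdes : IsExactDesign n (2 * c' + 1) T D Bv C w) (hD : D ≤ 2 * c') (hr : 0 < r)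
    (hlow : ∀ (X : OddSet n → Matrix (Fin r) (Fin r) ℝ) (Y : PMatch n → Matrix (Fin r) (Fin r) ℝ), IsPsdRect X Y →
      ∀ p : Fin r × Fin r → ℕ → Finset (Fin n) → ℝ, (∀ ab j, IsHarmonic j (p ab j)) →
        (∀ ab (U : OddSet n), U.1.card = 2 * c' + 1 →
          X U ab.1 ab.2 = (∑ j ∈ range (2 * c' + 1 + 1), up^[2 * c' + 1 - j] (p ab j)) U.1) →
        -(ε * r * (Fintype.card (PMatch n) : ℝ) * ((((n / 2).choose (1 + c') * (1 + c').choose c' * 2 ^ 1 : ℕ) : ℝ))) ≤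
          ∑ κ ∈ Icc 1 (D / 2),
            ((∏ i ∈ range κ, (((2 * c' + 1 : ℝ) - 2 * i) * ((n : ℝ) - 2 * c' - 1 - 2 * i) /
                (((2 * c' : ℝ) - 2 * i) * ((n : ℝ) - 2 * c' - 2 - 2 * i)))) - 1) *
              ∑ ab : Fin r × Fin r, ∑ M : PMatch n, Y M ab.2 ab.1 * ∑ U ∈ univ.powersetCard (2 * c' + 1),
                (up^[2 * c' + 1 - 2 * κ] (p ab (2 * κ))) U * (if (U.filter fun x => M.2.partner x ∉ U).card = 1 then (1 : ℝ) else 0)) :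
    TracialValueLEAt (levelWeight n (2 * c' + 1) C w)
      (ε + ((c' : ℝ) + Bv) * Real.sqrt (∏ i ∈ range (D / 2 + 1), ((2 * i + 1 : ℝ) / ((n : ℝ) - 2 * i)))) r := by
  classical
  have ht : 2 * (2 * c' + 1) ≤ n := by have := hdes.2.1; omega
  have hmain : TracialValueLEAt (levelWeight n (2 * c' + 1) C w)
      ((ε + (c' : ℝ) * Real.sqrt (∏ i ∈ range (D / 2 + 1), ((2 * i + 1 : ℝ) / ((n : ℝ) - 2 * i)))) +
        Bv * Real.sqrt (∏ i ∈ range (D / 2 + 1), ((2 * i + 1 : ℝ) / ((n : ℝ) - 2 * i)))) r := by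
    refine tracialValueLEAt_of_virtualNonneg hn hdes hD hr fun X Y hrect p hp hpdec => ?_
    have hPm : (0 : ℝ) < Fintype.card (PMatch n) := by exact_mod_cast card_pmatch_pos hn
    obtain ⟨hX, hY, htight0⟩ := hrect
    have htight : ∀ (U : OddSet n) (M : PMatch n), U.1.card = 2 * c' + 1 → cc U M = 1 → (X U * Y M).trace = 0 :=
      fun U M _ h1 => by rw [htight0 U M h1, trace_zero]
    have hbudget := tight_virtual_modeBudget hn ht hD X Y htight p hp hpdec
    have hl := hlow X Y ⟨hX, hY, htight0⟩ p hp hpdec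
    set N₁ : ℝ := ((((n / 2).choose (1 + c') * (1 + c').choose c' * 2 ^ 1 : ℕ) : ℝ)) with hN₁
    set Pm : ℝ := (Fintype.card (PMatch n) : ℝ) with hPmdef
    set Cm : ℕ → ℝ := fun κ => ∑ ab : Fin r × Fin r, ∑ M : PMatch n, Y M ab.2 ab.1 * ∑ U ∈ univ.powersetCard (2 * c' + 1),
      (up^[2 * c' + 1 - 2 * κ] (p ab (2 * κ))) U * (if (U.filter fun x => M.2.partner x ∉ U).card = 1 then (1 : ℝ) else 0) with hCm
    set R : ℕ → ℝ := fun κ => ∏ i ∈ range κ, (((2 * c' + 1 : ℝ) - 2 * i) * ((n : ℝ) - 2 * c' - 1 - 2 * i) /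
      (((2 * c' : ℝ) - 2 * i) * ((n : ℝ) - 2 * c' - 2 - 2 * i))) with hR
    set sA : ℕ → ℝ := fun κ => Real.sqrt (∏ i ∈ range κ, ((2 * i + 1 : ℝ) / ((n : ℝ) - 2 * i))) with hsA
    set V : ℝ := ∑ M : PMatch n, ∑ A : {A : Finset (Fin n) // A.card ≤ D},
          (Matrix.of (fun a b : Fin r =>
            (∑ j ∈ range (2 * c' + 1 + 1), ((2 * c' + 1 - j).factorial : ℝ) • (if D < j then 0 else p (a, b) j)) A.1) * Y M).trace *
            knapsackMoment M.1.card (((2 * c' + 1 : ℕ) : ℝ) / 2) (M.1.filter fun e => ∃ a ∈ A.1, a ∈ e).card with hV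
    change V * N₁ = ∑ κ ∈ Icc 1 (D / 2), (R κ - 1) * Cm κ - ∑ κ ∈ Icc (D / 2 + 1) c', Cm κ at hbudget
    change -(ε * r * Pm * N₁) ≤ ∑ κ ∈ Icc 1 (D / 2), (R κ - 1) * Cm κ at hl
    change -((ε + (c' : ℝ) * sA (D / 2 + 1)) * r) ≤ Pm⁻¹ * V
    have hN₁pos : 0 < N₁ := by
      rw [hN₁]
      have h1 : 0 < (n / 2).choose (1 + c') := Nat.choose_pos (by omega)
      have h2 : 0 < (1 + c').choose c' := Nat.choose_pos (by omega)
      exact_mod_cast Nat.mul_pos (Nat.mul_pos h1 h2) (by norm_num)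
    -- the deep modes
    have hCle : ∀ κ, κ ≤ c' → |Cm κ| ≤ (r : ℝ) * (Pm * N₁ * sA κ) := fun κ hκ => HSmode_abs_le hn ht hκ X Y hX hY p hp hpdec
    have hdeep : |∑ κ ∈ Icc (D / 2 + 1) c', Cm κ| ≤ (r : ℝ) * (Pm * N₁) * ((c' : ℝ) * sA (D / 2 + 1)) := by
      calc |∑ κ ∈ Icc (D / 2 + 1) c', Cm κ| ≤ ∑ κ ∈ Icc (D / 2 + 1) c', |Cm κ| := abs_sum_le_sum_abs _ _
        _ ≤ ∑ κ ∈ Icc (D / 2 + 1) c', (r : ℝ) * (Pm * N₁ * sA κ) := sum_le_sum fun κ hκ => hCle κ (mem_Icc.1 hκ).2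
        _ = (r : ℝ) * (Pm * N₁) * ∑ κ ∈ Icc (D / 2 + 1) c', sA κ := by rw [mul_sum]; exact sum_congr rfl fun κ _ => by ring
        _ ≤ (r : ℝ) * (Pm * N₁) * ((c' : ℝ) * sA (D / 2 + 1)) :=
            mul_le_mul_of_nonneg_left (deep_modes_le (n := n) (c' := c') (D := D) ht) (by positivity)
    have hVN : -((ε + (c' : ℝ) * sA (D / 2 + 1)) * r) * (Pm * N₁) ≤ V * N₁ := by
      rw [hbudget]
      have h1 := (abs_le.1 hdeep).2
      nlinarith [hl, h1]
    -- divide by `Pm·N₁ > 0`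
    have hkey : -((ε + (c' : ℝ) * sA (D / 2 + 1)) * r) * Pm ≤ V := by
      have := hVN
      rw [← mul_assoc] at this
      exact le_of_mul_le_mul_right this hN₁pos
    calc -((ε + (c' : ℝ) * sA (D / 2 + 1)) * r) = Pm⁻¹ * (-((ε + (c' : ℝ) * sA (D / 2 + 1)) * r) * Pm) := by
          field_simp
      _ ≤ Pm⁻¹ * V := mul_le_mul_of_nonneg_left hkey (inv_nonneg.2 hPm.le)
  refine fun X Y hXY => (hmain X Y hXY).trans_eq ?_
  ring

end Summit.PneNP.PneNP.Theorems.ChebyshevTracialDesignLowModeReduction
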